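import Summits.BirchSwinnertonDyer.BirchSwinnertonDyer.Theorems.SignedLowerHalvesSprungLowerDivisibilityAtThreeRobustBezoutMTLayers
import Literature.NumberTheory.EllipticCurves.IwasawaAlgebraStructureProofs
import HarnessLib

/-!
# Crux `SprungLowerDivisibilityAtThree` (K1, item stmt-BirchSwinnertonDyer-19875), line `chromatic-common-zeros`:
# the DEGREE-SPLIT robust Bézout lemma — per-degree certificates `(p, T^d)`, and the DIVISION certificate `F ∤ G`
# for the top degree (pure `Λ`-algebra, general `p`)

Cell `bsd-ssimc` (host), width seat `cruxlead-stmt-BirchSwinnertonDyer-19875-w2` (g4) under the 19875 lead; `--supports` 19875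
`--as helper`; THEOREMS ONLY; closes NO item. K1, BSD and leaf X8 are NOT proved by anything here.

Why. A height-one prime `𝔭 ∌ p` of `Λ = ℤ_p⟦T⟧` containing `F` (`μ(F) = 0`, `λ(F) = l`) is `(f)` for a distinguished irreducible `f`
of some degree `d ∈ [1, l]` (`IwasawaAlgebra.eq_span_of_height_eq_one`), and then `T^d ∈ 𝔭 + (p)` — so a graded Bézout certificate
with the LARGER ideal `J_d = (p, T^d)` already excludes the primes of degree `d`; and in the top degree `d = l` one has `𝔭 = (F)`, so a
common prime of degree `l` means `F ∣ G`, which is excluded by a DIVISION certificate: an element `R ∈ (F, G) + J_l^m` all of whose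
coefficients of index `≥ l` vanish and which is NOT divisible by `p^m` (for `G ∈ (F)` one would get `R ∈ (F) + (p^m)`, and a "polynomial"
of degree `< λ(F)` in `(F) + (p^m)` is divisible by `p^m` — Weierstrass division, proved here by induction on `m`). Data probe on the x8
census (exact Mazur–Tate records, n ≤ 5/6): the weighted multi-layer certificate w.r.t. `J_l` certifies 66/215 cells, the degree split
(per-degree Bézout for `d < l` + Bézout-or-division at `d = l`) 74/215.

## What is proved (namespace `…ChromaticRobustBezout`)

* `C_pow_dvd_of_mem_span_sup_of_coeff_eq_zero` — `μ(F) = 0`, `R ∈ (F) + (p^m)` with `R_i = 0` for `i ≥ λ(F)` ⟹ `C(p^m) ∣ R`.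
* `mu_lam_coe_of_isDistinguishedAt` — a distinguished `f ∈ ℤ_p[T]` has `μ = 0`, `λ = deg f` in `Λ`.
* `span_coe_eq_span_of_mem_of_lam_eq` — `𝔭 = (f) ∋ F`, `λ(f) = λ(F)`, `μ(F) = 0` ⟹ `(f) = (F)`.
* **`natCast_mem_of_splitCert`** — `F ≠ 0`, `μ(F) = 0`; for every `d` with `1 ≤ d < λ(F)` a Bézout certificate
  `C(p^{k}) ∈ (F, G) + J_d^{k+1}`; and for `d = λ(F)` EITHER such a certificate w.r.t. `J_{λ(F)}` OR a division certificate
  `R ∈ (F, G) + J_{λ(F)}^m`, `R_i = 0 (i ≥ λ(F))`, `C(p^m) ∤ R` ⟹ every HEIGHT-ONE prime containing `F` and `G` contains `p`.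

References: [Washington1997] §7.1 (Weierstrass preparation and division), §13.2 (height-one primes of `Λ`); tree:
`Literature/…/IwasawaAlgebraStructureProofs` (`IwasawaAlgebra.eq_span_of_height_eq_one`), `…RobustBezout` (§1/§1b), `…RobustBezoutMTLayers`.
-/

set_option autoImplicit false
-- justification: the mandated namespace `Summit.BirchSwinnertonDyer.BirchSwinnertonDyer.Theorems`
-- (single-conjunct summit, Sub = Summit) repeats a segment by design (D-0017).
set_option linter.dupNamespace false

noncomputable section

open scoped Classical Polynomial

open Polynomial Literature.NumberTheory.EllipticCurves Literature.NumberTheory.EllipticCurves.Sprung2017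
  Literature.NumberTheory.EllipticCurves.IwasawaAlgebra
  Summit.BirchSwinnertonDyer.Rank1Residual.X1.MuLambda
  Summit.BirchSwinnertonDyer.BirchSwinnertonDyer.Theorems.SlopePinch

namespace Summit.BirchSwinnertonDyer.BirchSwinnertonDyer.Theorems.ChromaticRobustBezout

section Split

variable {p : ℕ} [hp : Fact p.Prime]

/-- **Weierstrass-division divisibility, by induction on `m`**: if `μ(F) = 0` (`F ≠ 0`), `R = A·F + C(p^m)·B` and every coefficient
of `R` of index `≥ λ(F)` vanishes, then `C(p^m) ∣ R`. (Mod `p`, `A·F ≡ R` has order `≥ λ(F) >` every index where `R̄` could be non-zero,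
so `p ∣ R` and `p ∣ A`; divide by `p` and recurse.) [cite: Washington1997, §7.1] -/
theorem C_pow_dvd_of_eq_of_coeff_eq_zero {F : IwasawaAlgebra p} (hF : F ≠ 0) (hμ : mu F = 0) (m : ℕ) :
    ∀ (R A B : IwasawaAlgebra p), (∀ i, lam F ≤ i → PowerSeries.coeff i R = 0) →
      R = A * F + PowerSeries.C ((p : ℤ_[p]) ^ m) * B → (PowerSeries.C ((p : ℤ_[p]) ^ m) : IwasawaAlgebra p) ∣ R := by
  induction m with
  | zero => intro R A B _ _; rw [pow_zero, map_one]; exact one_dvd R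
  | succ m ih =>
    intro R A B hcoeff hRAB
    obtain ⟨-, hredF⟩ := pfree_eq_self_of_mu_eq_zero hF hμ
    have hordF : (red F).order = (lam F : ℕ∞) := order_red_eq_lam hF hμ
    -- `red R = red A * red F` has order `≥ λ(F)`, but all its coefficients of index `≥ λ(F)` vanish: `red R = 0`
    have hredR : red R = red A * red F := by
      have h1 : red R = red (A * F) + red (PowerSeries.C (p : ℤ_[p]) * (PowerSeries.C ((p : ℤ_[p]) ^ m) * B)) := by
        rw [hRAB, pow_succ', map_mul (PowerSeries.C (R := ℤ_[p])), mul_assoc]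
        exact map_add (PowerSeries.map (IsLocalRing.residue ℤ_[p])) _ _
      rw [h1, (red_eq_zero_iff _).mpr (dvd_mul_right (PowerSeries.C (p : ℤ_[p])) _), add_zero]
      exact map_mul (PowerSeries.map (IsLocalRing.residue ℤ_[p])) _ _
    have hredR0 : red R = 0 := by
      ext i
      rw [map_zero]
      by_cases hi : lam F ≤ i
      · rw [PowerSeries.coeff_map, hcoeff i hi, map_zero]
      · push Not at hi
        apply PowerSeries.coeff_of_lt_order
        rw [hredR]
        refine lt_of_lt_of_le ?_ (PowerSeries.le_order_mul _ _)
        rw [hordF]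
        exact lt_of_lt_of_le (by exact_mod_cast hi) le_add_self
    -- so `R = p·R₁`, and then `p ∣ A·F`, `p ∣ A`: `A = p·A₁`
    obtain ⟨R₁, hR₁⟩ := (red_eq_zero_iff R).mp hredR0
    have hpAF : (PowerSeries.C (p : ℤ_[p]) : IwasawaAlgebra p) ∣ A * F := by
      refine ⟨R₁ - PowerSeries.C ((p : ℤ_[p]) ^ m) * B, ?_⟩
      have h1 : A * F = R - PowerSeries.C ((p : ℤ_[p]) ^ (m + 1)) * B := by rw [hRAB]; ring
      rw [h1, hR₁, pow_succ', map_mul]; ring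
    have hredA : red A = 0 := by
      have h := (red_eq_zero_iff (A * F)).mpr hpAF
      have h2 : red A * red F = 0 := by
        rw [← h]; exact (map_mul (PowerSeries.map (IsLocalRing.residue ℤ_[p])) _ _).symm
      exact (mul_eq_zero.mp h2).resolve_right hredF
    obtain ⟨A₁, hA₁⟩ := (red_eq_zero_iff A).mp hredA
    -- divide by `p`: `R₁ = A₁·F + C(p^m)·B`, and `R₁` has the same vanishing coefficients
    have hC0 : (PowerSeries.C (p : ℤ_[p]) : IwasawaAlgebra p) ≠ 0 := by
      have h := C_pow_ne_zero (p := p) 1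
      rwa [pow_one] at h
    have hR₁eq : R₁ = A₁ * F + PowerSeries.C ((p : ℤ_[p]) ^ m) * B := by
      refine mul_left_cancel₀ hC0 ?_
      rw [← hR₁, hRAB, hA₁, pow_succ', map_mul]; ring
    have hcoeff₁ : ∀ i, lam F ≤ i → PowerSeries.coeff i R₁ = 0 := by
      intro i hi
      have h := hcoeff i hi
      rw [hR₁, PowerSeries.coeff_C_mul, mul_eq_zero] at h
      exact h.resolve_left (by exact_mod_cast hp.out.ne_zero)
    obtain ⟨D, hD⟩ := ih R₁ A₁ B hcoeff₁ hR₁eq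
    refine ⟨D, ?_⟩
    rw [hR₁, hD, pow_succ', map_mul, mul_assoc]

/-- Membership form: `R ∈ (F) + (C(p^m))` with `R_i = 0` for `i ≥ λ(F)` ⟹ `C(p^m) ∣ R`. [cite: Washington1997, §7.1] -/
theorem C_pow_dvd_of_mem_span_sup_of_coeff_eq_zero {F R : IwasawaAlgebra p} (hF : F ≠ 0) (hμ : mu F = 0) {m : ℕ}
    (hcoeff : ∀ i, lam F ≤ i → PowerSeries.coeff i R = 0)
    (hR : R ∈ Ideal.span {F} ⊔ Ideal.span {(PowerSeries.C ((p : ℤ_[p]) ^ m) : IwasawaAlgebra p)}) :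
    (PowerSeries.C ((p : ℤ_[p]) ^ m) : IwasawaAlgebra p) ∣ R := by
  obtain ⟨x, hx, y, hy, hxy⟩ := Submodule.mem_sup.mp hR
  obtain ⟨A, rfl⟩ := Ideal.mem_span_singleton'.mp hx
  obtain ⟨B, rfl⟩ := Ideal.mem_span_singleton'.mp hy
  exact C_pow_dvd_of_eq_of_coeff_eq_zero hF hμ m R A B hcoeff (by rw [← hxy]; ring)

/-- A distinguished polynomial `f ∈ ℤ_p[T]` has `μ = 0` and `λ = deg f` in `Λ` (`f ≡ T^{deg f} (mod p)`). [cite: Washington1997, §7.1] -/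
theorem mu_lam_coe_of_isDistinguishedAt {f : ℤ_[p][X]} (hf : f.IsDistinguishedAt (IsLocalRing.maximalIdeal ℤ_[p])) :
    mu ((f : IwasawaAlgebra p)) = 0 ∧ lam ((f : IwasawaAlgebra p)) = f.natDegree := by
  have hred : red ((f : IwasawaAlgebra p)) = PowerSeries.X ^ f.natDegree := by
    have h : Polynomial.map (IsLocalRing.residue ℤ_[p]) f = Polynomial.X ^ f.natDegree := hf.map_eq_X_pow
    change PowerSeries.map (IsLocalRing.residue ℤ_[p]) _ = _
    rw [← Polynomial.polynomial_map_coe, h, Polynomial.coe_pow, Polynomial.coe_X]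
  have hne : red ((f : IwasawaAlgebra p)) ≠ 0 := by rw [hred]; exact pow_ne_zero _ PowerSeries.X_ne_zero
  obtain ⟨hμ, hpf⟩ := mu_eq_and_pfree_eq (a := 0) hne (by rw [pow_zero, map_one, one_mul])
  refine ⟨hμ, ?_⟩
  rw [lam, hpf, hred, PowerSeries.order_X_pow]
  exact ENat.toNat_coe _

/-- **The top degree: `(f) ∋ F` with `λ(f) = λ(F)`, `μ(F) = 0` forces `(f) = (F)`** (`F = f·h` with `μ(h) = λ(h) = 0`, i.e. `h ∈ Λˣ`).
[cite: Washington1997, §7.1] -/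
theorem span_coe_eq_span_of_mem_of_lam_eq {f : ℤ_[p][X]} {F : IwasawaAlgebra p}
    (hf : f.IsDistinguishedAt (IsLocalRing.maximalIdeal ℤ_[p])) (hF : F ≠ 0) (hμ : mu F = 0)
    (hmem : F ∈ Ideal.span {(f : IwasawaAlgebra p)}) (hlam : lam ((f : IwasawaAlgebra p)) = lam F) :
    Ideal.span {(f : IwasawaAlgebra p)} = Ideal.span {F} := by
  obtain ⟨h, hfh⟩ := Ideal.mem_span_singleton'.mp hmem
  -- `F = h * f`
  have hf0 : ((f : IwasawaAlgebra p)) ≠ 0 := fun h0 => hF (by rw [← hfh, h0, mul_zero])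
  have hh0 : h ≠ 0 := fun h0 => hF (by rw [← hfh, h0, zero_mul])
  have hμfh := mu_mul hh0 hf0
  have hlfh := lam_mul hh0 hf0
  rw [hfh] at hμfh hlfh
  have hμf := (mu_lam_coe_of_isDistinguishedAt hf).1
  have hunit : IsUnit h := by
    rw [isUnit_iff_mu_eq_zero_and_lam_eq_zero]
    refine ⟨hh0, by omega, by omega⟩
  rw [← hfh]
  exact (Ideal.span_singleton_mul_left_unit hunit _).symm

/-- **THE DEGREE-SPLIT ROBUST BÉZOUT LEMMA.** Let `F, G ∈ Λ`, `F ≠ 0`, `μ(F) = 0`, `l = λ(F)`, and suppose: for every degree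
`d` with `1 ≤ d < l` a Bézout certificate `C(p^k) ∈ (F, G) + (p, T^d)^{k+1}` (some `k`); and for the top degree `d = l` EITHER such a
certificate w.r.t. `(p, T^l)` OR a DIVISION certificate: some `R ∈ (F, G) + (p, T^l)^m` whose coefficients of index `≥ l` vanish and
with `C(p^m) ∤ R`. Then every HEIGHT-ONE prime of `Λ` containing `F` and `G` contains `p`. Proof: such a prime is `(p)` or `(f)` with
`f` distinguished irreducible of degree `d ∈ [1, l]` and `T^d ∈ (f) + (p)`; for `d < l` (or the Bézout branch at `d = l`) conclude by
`mem_of_bezout_congr`; for `d = l`, `(f) = (F) ∋ G` and the division certificate is contradicted by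
`C_pow_dvd_of_mem_span_sup_of_coeff_eq_zero`. [cite: Washington1997, §7.1 and §13.2] -/
theorem natCast_mem_of_splitCert {F G : IwasawaAlgebra p} (hF : F ≠ 0) (hμ : mu F = 0)
    (hlow : ∀ d, 1 ≤ d → d < lam F → ∃ k : ℕ, (PowerSeries.C ((p : ℤ_[p]) ^ k) : IwasawaAlgebra p) ∈
      Ideal.span {F, G} ⊔ (Ideal.span {(PowerSeries.C (p : ℤ_[p]) : IwasawaAlgebra p), PowerSeries.X ^ d}) ^ (k + 1))
    (htop : (∃ k : ℕ, (PowerSeries.C ((p : ℤ_[p]) ^ k) : IwasawaAlgebra p) ∈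
        Ideal.span {F, G} ⊔ (Ideal.span {(PowerSeries.C (p : ℤ_[p]) : IwasawaAlgebra p), PowerSeries.X ^ lam F}) ^ (k + 1)) ∨
      (∃ (m : ℕ) (R : IwasawaAlgebra p),
        R ∈ Ideal.span {F, G} ⊔ (Ideal.span {(PowerSeries.C (p : ℤ_[p]) : IwasawaAlgebra p), PowerSeries.X ^ lam F}) ^ m ∧
        (∀ i, lam F ≤ i → PowerSeries.coeff i R = 0) ∧ ¬ (PowerSeries.C ((p : ℤ_[p]) ^ m) : IwasawaAlgebra p) ∣ R))
    (𝔭 : PrimeSpectrum (IwasawaAlgebra p)) (h𝔭 : 𝔭.asIdeal.height = 1) (hF𝔭 : F ∈ 𝔭.asIdeal) (hG𝔭 : G ∈ 𝔭.asIdeal) :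
    ((p : ℕ) : IwasawaAlgebra p) ∈ 𝔭.asIdeal := by
  -- a Bézout certificate w.r.t. `(p, T^d)` kills `𝔭` as soon as `T^d ∈ 𝔭 + (p)`
  have bezout : ∀ d k : ℕ, (PowerSeries.X : IwasawaAlgebra p) ^ d ∈
      𝔭.asIdeal ⊔ Ideal.span {(PowerSeries.C (p : ℤ_[p]) : IwasawaAlgebra p)} →
      (PowerSeries.C ((p : ℤ_[p]) ^ k) : IwasawaAlgebra p) ∈
        Ideal.span {F, G} ⊔ (Ideal.span {(PowerSeries.C (p : ℤ_[p]) : IwasawaAlgebra p), PowerSeries.X ^ d}) ^ (k + 1) →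
      ((p : ℕ) : IwasawaAlgebra p) ∈ 𝔭.asIdeal := by
    intro d k hXd hk
    have hFG : Ideal.span {F, G} ≤ 𝔭.asIdeal := by
      rw [Ideal.span_insert, sup_le_iff, Ideal.span_singleton_le_iff_mem, Ideal.span_singleton_le_iff_mem]
      exact ⟨hF𝔭, hG𝔭⟩
    have hmem : (PowerSeries.C ((p : ℤ_[p]) ^ k) : IwasawaAlgebra p) ∈
        𝔭.asIdeal ⊔ Ideal.span {(PowerSeries.C ((p : ℤ_[p]) ^ (k + 1)) : IwasawaAlgebra p)} :=
      (sup_le (hFG.trans le_sup_left) (certIdeal_pow_le_sup hXd (k + 1))) hk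
    -- `p^k = q + p^{k+1} y`, `q ∈ 𝔭` ⇒ `p^k (1 − p y) ∈ 𝔭` ⇒ `p ∈ 𝔭`
    have hmem' : ((p : ℕ) : IwasawaAlgebra p) ^ k ∈ 𝔭.asIdeal ⊔ Ideal.span {((p : ℕ) : IwasawaAlgebra p) ^ (k + 1)} := by
      rw [← C_natCast_pow k, ← C_natCast_pow (k + 1)]
      exact hmem
    have hid : (0 : IwasawaAlgebra p) * F + 0 * G = ((p : ℕ) : IwasawaAlgebra p) ^ k + (-(((p : ℕ) : IwasawaAlgebra p) ^ k)) := by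
      ring
    refine mem_of_bezout_congr 𝔭.isPrime natCast_mem_jacobson_bot hid ?_ hF𝔭 hG𝔭
    exact neg_mem_iff.mpr hmem'
  rcases IwasawaAlgebra.eq_span_of_height_eq_one p 𝔭.asIdeal h𝔭 with h𝔭p | ⟨f, hf, hirr, h𝔭f⟩
  · rw [h𝔭p, ← map_natCast (PowerSeries.C (R := ℤ_[p])) p]
    exact Ideal.mem_span_singleton_self _
  · -- `𝔭 = (f)`, `f` distinguished of degree `d`, `1 ≤ d ≤ λ(F)`, `T^d ∈ 𝔭 + (p)`
    obtain ⟨hμf, hlf⟩ := mu_lam_coe_of_isDistinguishedAt (p := p) hf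
    have hf0 : ((f : IwasawaAlgebra p)) ≠ 0 := fun h0 => hirr.ne_zero (by exact_mod_cast h0)
    have hfmem : ((f : IwasawaAlgebra p)) ∈ 𝔭.asIdeal := by rw [h𝔭f]; exact Ideal.mem_span_singleton_self _
    have hXd : (PowerSeries.X : IwasawaAlgebra p) ^ f.natDegree ∈
        𝔭.asIdeal ⊔ Ideal.span {(PowerSeries.C (p : ℤ_[p]) : IwasawaAlgebra p)} := by
      rw [← hlf]; exact X_pow_lam_mem_sup hf0 hμf hfmem
    -- `d ≤ λ(F)` since `f ∣ F`
    have hdle : f.natDegree ≤ lam F := by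
      rw [h𝔭f] at hF𝔭
      obtain ⟨h, hfh⟩ := Ideal.mem_span_singleton'.mp hF𝔭
      have hh0 : h ≠ 0 := fun h0 => hF (by rw [← hfh, h0, zero_mul])
      have := lam_mul hh0 hf0
      rw [hfh, hlf] at this
      omega
    -- `d ≥ 1`: a distinguished polynomial of degree `0` is `1`
    have hd1 : 1 ≤ f.natDegree := by
      by_contra h0
      push Not at h0
      have hdeg : f.natDegree = 0 := by omega
      have hf1 : f = 1 := by
        rw [Polynomial.eq_C_of_natDegree_eq_zero hdeg]
        have hlc := hf.monic.leadingCoeff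
        rw [Polynomial.leadingCoeff, hdeg] at hlc
        rw [hlc, map_one]
      apply 𝔭.isPrime.ne_top
      rw [h𝔭f, hf1, Polynomial.coe_one, Ideal.span_singleton_one]
    rcases Nat.lt_or_ge f.natDegree (lam F) with hlt | hge
    · obtain ⟨k, hk⟩ := hlow f.natDegree hd1 hlt
      exact bezout f.natDegree k hXd hk
    · have hdeq : f.natDegree = lam F := le_antisymm hdle hge
      rcases htop with ⟨k, hk⟩ | ⟨m, R, hR, hcoeff, hndvd⟩
      · exact bezout (lam F) k (hdeq ▸ hXd) hk
      · -- `𝔭 = (F) ∋ G`: the division certificate is contradicted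
        exfalso
        have hspan : Ideal.span {((f : IwasawaAlgebra p))} = Ideal.span {F} :=
          span_coe_eq_span_of_mem_of_lam_eq hf hF hμ (by rw [← h𝔭f]; exact hF𝔭) (by rw [hlf, hdeq])
        have hG' : G ∈ Ideal.span {F} := by rw [← hspan, ← h𝔭f]; exact hG𝔭
        have hFG : Ideal.span {F, G} ≤ Ideal.span {F} := by
          rw [Ideal.span_insert, sup_le_iff, Ideal.span_singleton_le_iff_mem, Ideal.span_singleton_le_iff_mem]
          exact ⟨Ideal.mem_span_singleton_self F, hG'⟩
        have hXl : (PowerSeries.X : IwasawaAlgebra p) ^ lam F ∈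
            Ideal.span {F} ⊔ Ideal.span {(PowerSeries.C (p : ℤ_[p]) : IwasawaAlgebra p)} :=
          X_pow_lam_mem_sup hF hμ (Ideal.mem_span_singleton_self F)
        have hR' : R ∈ Ideal.span {F} ⊔ Ideal.span {(PowerSeries.C ((p : ℤ_[p]) ^ m) : IwasawaAlgebra p)} :=
          (sup_le (hFG.trans le_sup_left) (certIdeal_pow_le_sup hXl m)) hR
        exact hndvd (C_pow_dvd_of_mem_span_sup_of_coeff_eq_zero hF hμ hcoeff hR')

end Split

end Summit.BirchSwinnertonDyer.BirchSwinnertonDyer.Theorems.ChromaticRobustBezout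

end
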